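import Mathlib
import Summits.ValiantsHypothesis.ValiantsHypothesis.Theorems.KPlusLogSqLawWeakLiftingTowerGraftSkewBlockPhantoms

/-!
# Tower graft line — THE SKEW-BLOCK CORNER FAMILY CROSSES TWICE AT EVERY ROOT OF `det B` (the quantitative half)

Calibration file for the line `Cruxes/WeakLifting/Lines/tower_graft.lean` (crux `WeakLifting` = stmt-ValiantsHypothesis-19561; S4b
`stub_graftLawCorner`, memo `Lines/tower_graft-S5.md` §3 T1/T2; crit-6 kill-shape #38⁺ «instance-level graft law below the class
maximum»).  NO stub is claimed.  Companion of `…TowerGraftSkewBlockPhantoms.lean` (the structural half: for the skew-block letters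
`S_{l₀} = [[η·1, B_{l₀}],[B_{l₀}ᵀ, −η·1]]`, `S_l = [[0, B_l],[B_lᵀ, 0]]`, BOTH digits `det G_η`, `det (G_η)ᵢᵢ` of a corner graft at an index of
the negative block are ROOTLESS on `(0,∞)` for every `η ≠ 0`).

THIS FILE (all sizes `p`, `q + 1`, all `K`, every support `d`, every far exponent `D`, every family of blocks `B_l : p × (q+1)`):
* `det_skewBlock_add_corner` — Schur with the corner: `det([[c·1, B],[Bᵀ, −c·1]] + g·E_{inr j}) = c^p(−c⁻¹)^q·(g·det(c²·1 + B″ᵀB″) − c⁻¹·det(c²·1 + BᵀB))`,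
  `B″ = B` minus column `j`;
* the crossing polynomial IN `η` at a fixed point `t`: `Φ_t(η) = η·t^{d_{l₀}+D}·det(η²t^{2d_{l₀}}·1 + B″(t)ᵀB″(t)) − det(η²t^{2d_{l₀}}·1 + B(t)ᵀB(t))`
  has constant coefficient `−det(B(t)ᵀB(t))` and linear coefficient `t^{d_{l₀}+D}·det(B″(t)ᵀB″(t))` (`coeff_zero/one_det_sq_smul_one_add`,
  the latter because `det(c₀X²·1 + M)` is a polynomial in `X²`, `det_sq_smul_one_add_eq_expand`), and the graft evaluated at `t` is a multiple of
  `Φ_t(η)` of the fixed sign `(−1)^q` (`neg_one_pow_mul_skewFactor_pos`);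
* **`skewBlock_crossings`** — if positive points `τ₀ < ρ₀ < τ₁ < ⋯ < ρ_{N−1} < τ_N` have `B(τᵢ)ᵀB(τᵢ)` non-singular, `B(ρᵢ)ᵀB(ρᵢ)` SINGULAR and
  `B″(ρᵢ)ᵀB″(ρᵢ)` non-singular, then for some `η > 0` the corner graft `det(G_η + X^D·E_{inr j})` has **at least `2N` distinct positive roots**
  (sign persistence of `Φ_{τᵢ}` near `η = 0`, first-order positivity of `Φ_{ρᵢ}`, one `η` below all thresholds, IVT certificate);
* **`skewBlock_phantoms`** — the same `η` packaged with the structural half: `Z₊(det G_η) = 0 ∧ Z₊(det (G_η)_{inr j, inr j}) = 0 ∧ 2N ≤ Z₊(graft)`;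
  `skewBlock_phantoms_square` — for square `B` (`p = q + 1`) the hypotheses read `det B(τᵢ) ≠ 0`, `det B(ρᵢ) = 0`, `B″(ρᵢ)` of full rank.

STATUS WORDS (crit-6 READ #128 (c2)): kill-shape #38⁺ «instance-level graft law below the class maximum» — KERNEL (qualitative: for every
`N` admitted by a `B`-pencil there are letters with `Z₊(digits) = 0 < 2N ≤ Z₊(graft)`, this file + `…SkewBlockPhantoms`) / LOCATED (the `(k,3)`
tower `B` with `N = ζ(k,3) = (k²+3k)/2` simple crossings, `exp/skewblock_k3.py`).
READING (the input «`det B` has `N` positive roots with `B″` of full rank there» stays an explicit hypothesis): with `B` ranging over Descartes-rich `(k,3)` tower pencils (`ζ(k,3) = (k²+3k)/2`, tree `…KThreeColumnLawHolds.not_posRootLawAt_three`;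
the full-rank side condition is generic and is what a located instance checks — `HOME/val-sym-lift-p2/g19/exp/skewblock_k3.py`: k = 2, 5 roots,
10 certified crossings), corner grafts on towers carry `≈ k² + 3k = m²/4 + 3m/2` positive roots while BOTH digits are rootless: no
instance-level corner law `Z₊(h) ≤ c·(Z₊(A) + Z₊(E)) + o(ζ₊(m;d))` exists; only the class maximum (S4b's currency, `2^C·B`) pays — S4b itself is
untouched (`B ≥ ζ₊ ≥ (m²+3m)/2` covers the count at `C = 1`).
HONEST FRAMING: linear algebra, one-variable sign persistence, an IVT certificate; nothing on S4/S4b/S5/S5ᴸ, TowerB, `WeakLifting`,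
Conjecture B, `MatrixDescartes` (18050) or `VP ≠ VNP`.  Def-free.  Seat: prover val-sym-lift-p2 g19, `--supports stmt-ValiantsHypothesis-19561`.
-/

-- `Summit.ValiantsHypothesis.ValiantsHypothesis.…` repeats a component by the D-0017 layout
-- (single-conjunct summit), which the `dupNamespace` linter flags; the name is mandated.
set_option linter.dupNamespace false

namespace Summit.ValiantsHypothesis.ValiantsHypothesis.Theorems.KPlusLogSqLaw.TowerGraft

open Polynomial Matrix
open scoped BigOperators Polynomial

section Crossings

variable {n : Type*} [Fintype n] [DecidableEq n]

/-- evaluating `det ((c₀·X²)·1 + M)` at `η` gives `det ((c₀ η²)·1 + M)`. [folklore] -/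
theorem eval_det_sq_smul_one_add (c₀ : ℝ) (M : Matrix n n ℝ) (η : ℝ) :
    (((C c₀ * X ^ 2) • (1 : Matrix n n ℝ[X]) + M.map C).det).eval η = ((c₀ * η ^ 2) • (1 : Matrix n n ℝ) + M).det := by
  have h := RingHom.map_det (Polynomial.evalRingHom η) ((C c₀ * X ^ 2) • (1 : Matrix n n ℝ[X]) + M.map C)
  rw [Polynomial.coe_evalRingHom] at h
  rw [h]
  congr 1
  ext i j
  simp only [RingHom.mapMatrix_apply, Matrix.map_apply, Matrix.add_apply, Matrix.smul_apply, Matrix.one_apply, smul_eq_mul,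
    mul_ite, mul_one, mul_zero, Polynomial.coe_evalRingHom]
  split_ifs <;> simp

/-- its constant coefficient is `det M`. [folklore] -/
theorem coeff_zero_det_sq_smul_one_add (c₀ : ℝ) (M : Matrix n n ℝ) :
    (((C c₀ * X ^ 2) • (1 : Matrix n n ℝ[X]) + M.map C).det).coeff 0 = M.det := by
  rw [coeff_zero_eq_eval_zero, eval_det_sq_smul_one_add]; simp

/-- it is a polynomial in `X²`: `det ((c₀·X²)·1 + M) = expand 2 (det ((c₀·X)·1 + M))`. [folklore] -/
theorem det_sq_smul_one_add_eq_expand (c₀ : ℝ) (M : Matrix n n ℝ) :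
    ((C c₀ * X ^ 2) • (1 : Matrix n n ℝ[X]) + M.map C).det =
      expand ℝ 2 (((C c₀ * X) • (1 : Matrix n n ℝ[X]) + M.map C).det) := by
  have h := RingHom.map_det ((expand ℝ 2 : ℝ[X] →ₐ[ℝ] ℝ[X]) : ℝ[X] →+* ℝ[X]) ((C c₀ * X) • (1 : Matrix n n ℝ[X]) + M.map C)
  rw [AlgHom.coe_toRingHom] at h
  rw [h]
  congr 1
  refine Matrix.ext fun i j => ?_
  simp only [RingHom.mapMatrix_apply, Matrix.map_apply, Matrix.add_apply, Matrix.smul_apply, Matrix.one_apply, smul_eq_mul,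
    mul_ite, mul_one, mul_zero, AlgHom.coe_toRingHom]
  split_ifs <;> simp [expand_X]

/-- hence its linear coefficient vanishes. [folklore] -/
theorem coeff_one_det_sq_smul_one_add (c₀ : ℝ) (M : Matrix n n ℝ) :
    (((C c₀ * X ^ 2) • (1 : Matrix n n ℝ[X]) + M.map C).det).coeff 1 = 0 := by
  rw [det_sq_smul_one_add_eq_expand, coeff_expand two_pos]
  simp

/-- sign persistence at `0`: a polynomial negative at `0` is negative on `(0, η₀)`. [folklore] -/
theorem exists_pos_forall_eval_neg (P : ℝ[X]) (h : P.eval 0 < 0) : ∃ η₀ : ℝ, 0 < η₀ ∧ ∀ η, 0 < η → η < η₀ → P.eval η < 0 := by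
  have hc : ContinuousAt (fun x => P.eval x) 0 := P.continuous.continuousAt
  have hev : ∀ᶠ x in nhds (0 : ℝ), P.eval x < 0 := hc.eventually (gt_mem_nhds h)
  obtain ⟨ε, hε, hball⟩ := Metric.eventually_nhds_iff.mp hev
  refine ⟨ε, hε, fun η hη hηε => hball ?_⟩
  simpa [Real.dist_eq, abs_of_pos hη] using hηε

/-- a polynomial with `P(0) = 0 < P'(0)` is positive on `(0, η₀)`. [folklore] -/
theorem exists_pos_forall_eval_pos_of_coeff (P : ℝ[X]) (h0 : P.coeff 0 = 0) (h1 : 0 < P.coeff 1) :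
    ∃ η₀ : ℝ, 0 < η₀ ∧ ∀ η, 0 < η → η < η₀ → 0 < P.eval η := by
  have hP : P = X * P.divX := by
    have := X_mul_divX_add P
    rw [h0, C_0, add_zero] at this
    exact this.symm
  have hQ : 0 < (-P.divX).eval 0 → False := fun h => by
    rw [eval_neg, ← coeff_zero_eq_eval_zero, coeff_divX] at h; linarith
  have hQ0 : (-P.divX).eval 0 < 0 := by
    rw [eval_neg, ← coeff_zero_eq_eval_zero, coeff_divX]; linarith
  obtain ⟨η₀, hη₀, hneg⟩ := exists_pos_forall_eval_neg (-P.divX) hQ0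
  refine ⟨η₀, hη₀, fun η hη hηη => ?_⟩
  have h2 := hneg η hη hηη
  rw [eval_neg] at h2
  rw [hP, eval_mul, eval_X]
  exact mul_pos hη (by linarith)


/-! ### The skew block with a corner in the negative block -/

variable {p q : ℕ}

/-- `BᵀB` is positive semidefinite (real matrices). [folklore] -/
theorem posSemidef_transpose_mul_self (B : Matrix (Fin p) (Fin q) ℝ) : (Bᵀ * B).PosSemidef := by
  simpa [Matrix.conjTranspose_eq_transpose_of_trivial] using Matrix.posSemidef_conjTranspose_mul_self B

/-- the corner at an index of the second block only touches the lower-right block. [folklore] -/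
theorem skewBlock_add_corner (c g : ℝ) (B : Matrix (Fin p) (Fin (q + 1)) ℝ) (j : Fin (q + 1)) :
    Matrix.fromBlocks (c • (1 : Matrix (Fin p) (Fin p) ℝ)) B Bᵀ (-(c • (1 : Matrix (Fin (q + 1)) (Fin (q + 1)) ℝ))) +
        g • Matrix.single (Sum.inr j : Fin p ⊕ Fin (q + 1)) (Sum.inr j) (1 : ℝ) =
      Matrix.fromBlocks (c • (1 : Matrix (Fin p) (Fin p) ℝ)) B Bᵀ
        (-(c • (1 : Matrix (Fin (q + 1)) (Fin (q + 1)) ℝ)) + g • Matrix.single j j (1 : ℝ)) := by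
  ext (a | a) (b | b) <;> simp [Matrix.fromBlocks, Matrix.single_apply]

/-- a principal minor of `c²·1 + BᵀB` is `c²·1 + B″ᵀB″` with `B″ = B` minus a column. [folklore] -/
theorem submatrix_sq_smul_one_add_transpose_mul_self (c : ℝ) (B : Matrix (Fin p) (Fin (q + 1)) ℝ) (j : Fin (q + 1)) :
    (c ^ 2 • (1 : Matrix (Fin (q + 1)) (Fin (q + 1)) ℝ) + Bᵀ * B).submatrix j.succAbove j.succAbove =
      c ^ 2 • (1 : Matrix (Fin q) (Fin q) ℝ) + (B.submatrix id j.succAbove)ᵀ * B.submatrix id j.succAbove := by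
  ext a b
  simp [Matrix.submatrix_apply, Matrix.mul_apply, Matrix.one_apply, Fin.succAbove_right_injective.eq_iff]

/-- **SCHUR WITH A CORNER**: `det ([[c·1, B],[Bᵀ, −c·1]] + g·E_{inr j}) = c^p (−c⁻¹)^q · (g·det(c²·1 + B″ᵀB″) − c⁻¹·det(c²·1 + BᵀB))`. [this work] -/
theorem det_skewBlock_add_corner (c : ℝ) (hc : c ≠ 0) (g : ℝ) (B : Matrix (Fin p) (Fin (q + 1)) ℝ) (j : Fin (q + 1)) :
    (Matrix.fromBlocks (c • (1 : Matrix (Fin p) (Fin p) ℝ)) B Bᵀ (-(c • (1 : Matrix (Fin (q + 1)) (Fin (q + 1)) ℝ))) +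
        g • Matrix.single (Sum.inr j : Fin p ⊕ Fin (q + 1)) (Sum.inr j) (1 : ℝ)).det =
      c ^ p * (-c⁻¹) ^ q * (g * (c ^ 2 • (1 : Matrix (Fin q) (Fin q) ℝ) +
          (B.submatrix id j.succAbove)ᵀ * B.submatrix id j.succAbove).det -
        c⁻¹ * (c ^ 2 • (1 : Matrix (Fin (q + 1)) (Fin (q + 1)) ℝ) + Bᵀ * B).det) := by
  rw [skewBlock_add_corner]
  haveI : Invertible (c • (1 : Matrix (Fin p) (Fin p) ℝ)) :=
    invertibleOfLeftInverse _ (c⁻¹ • (1 : Matrix (Fin p) (Fin p) ℝ)) (by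
      rw [smul_mul_smul_comm, Matrix.one_mul, inv_mul_cancel₀ hc, one_smul])
  have hinv : ⅟(c • (1 : Matrix (Fin p) (Fin p) ℝ)) = c⁻¹ • (1 : Matrix (Fin p) (Fin p) ℝ) :=
    invOf_eq_left_inv (by rw [smul_mul_smul_comm, Matrix.one_mul, inv_mul_cancel₀ hc, one_smul])
  rw [Matrix.det_fromBlocks₁₁, hinv, Matrix.det_smul, Matrix.det_one, mul_one, Fintype.card_fin]
  have hS : -(c • (1 : Matrix (Fin (q + 1)) (Fin (q + 1)) ℝ)) + g • Matrix.single j j (1 : ℝ) -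
        Bᵀ * (c⁻¹ • (1 : Matrix (Fin p) (Fin p) ℝ)) * B =
      (-c⁻¹) • (c ^ 2 • (1 : Matrix (Fin (q + 1)) (Fin (q + 1)) ℝ) + Bᵀ * B) + g • Matrix.single j j (1 : ℝ) := by
    rw [Matrix.mul_smul, Matrix.mul_one, Matrix.smul_mul, smul_add, smul_smul, neg_mul, sq, ← mul_assoc, inv_mul_cancel₀ hc,
      one_mul, neg_smul, neg_smul]
    abel
  rw [hS, det_add_smul_single_diag,
    show ((-c⁻¹) • (c ^ 2 • (1 : Matrix (Fin (q + 1)) (Fin (q + 1)) ℝ) + Bᵀ * B)).submatrix j.succAbove j.succAbove =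
      (-c⁻¹) • ((c ^ 2 • (1 : Matrix (Fin (q + 1)) (Fin (q + 1)) ℝ) + Bᵀ * B).submatrix j.succAbove j.succAbove) from rfl,
    submatrix_sq_smul_one_add_transpose_mul_self, Matrix.det_smul, Matrix.det_smul, Fintype.card_fin, Fintype.card_fin, pow_succ]
  field_simp
  ring

/-- evaluating the grafted pencil: `det` commutes with evaluation. [folklore] -/
theorem eval_det_pencil_add_corner {ι m : Type*} [Fintype ι] [Fintype m] [DecidableEq m] (S : ι → Matrix m m ℝ) (d : ι → ℕ)
    (D : ℕ) (a : m) (t : ℝ) :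
    (((∑ l, (X : ℝ[X]) ^ d l • (S l).map C) + (X : ℝ[X]) ^ D • Matrix.single a a (1 : ℝ[X])).det).eval t =
      ((∑ l, t ^ d l • S l) + t ^ D • Matrix.single a a (1 : ℝ)).det := by
  have h := RingHom.map_det (Polynomial.evalRingHom t)
    ((∑ l, (X : ℝ[X]) ^ d l • (S l).map C) + (X : ℝ[X]) ^ D • Matrix.single a a (1 : ℝ[X]))
  rw [Polynomial.coe_evalRingHom] at h
  rw [h]
  congr 1
  ext i j
  simp only [RingHom.mapMatrix_apply, Matrix.map_apply, Matrix.add_apply, Matrix.smul_apply, Matrix.sum_apply,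
    Polynomial.coe_evalRingHom, Polynomial.eval_add, Polynomial.eval_finsetSum, smul_eq_mul, Polynomial.eval_mul,
    Polynomial.eval_pow, Polynomial.eval_X, Polynomial.eval_C, Matrix.single_apply]
  congr 1
  split_ifs <;> simp

/-- the sign factor `c^p·(−c⁻¹)^q·c⁻¹` of the corner graft has the sign `(−1)^q` for `c > 0`. [folklore] -/
theorem neg_one_pow_mul_skewFactor_pos {c : ℝ} (hc : 0 < c) (p q : ℕ) :
    0 < (-1 : ℝ) ^ q * (c ^ p * (-c⁻¹) ^ q * c⁻¹) := by
  have h1 : (-1 : ℝ) ^ q * (c ^ p * (-c⁻¹) ^ q * c⁻¹) = c ^ p * (c⁻¹) ^ q * c⁻¹ := by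
    rw [neg_pow c⁻¹, show (-1 : ℝ) ^ q * (c ^ p * ((-1) ^ q * c⁻¹ ^ q) * c⁻¹) =
      ((-1 : ℝ) ^ q * (-1) ^ q) * (c ^ p * c⁻¹ ^ q * c⁻¹) by ring, ← mul_pow, neg_one_mul, neg_neg, one_pow, one_mul]
  rw [h1]
  positivity

/-- **THE SKEW-BLOCK FAMILY CROSSES TWICE AT EVERY ROOT OF `det B` (quantitative half, all sizes).**  Skew-block letters on any
support, corner at an index `inr j` of the negative block, `B(t) = Σₗ t^{dₗ} Bₗ` of shape `p × (q+1)`.  If positive points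
`τ₀ < ρ₀ < τ₁ < ρ₁ < ⋯ < ρ_{N−1} < τ_N` satisfy: `B(τᵢ)ᵀB(τᵢ)` non-singular, `B(ρᵢ)ᵀB(ρᵢ)` SINGULAR (for `p = q + 1`: `det B(ρᵢ) = 0`) and
`B″(ρᵢ)ᵀB″(ρᵢ)` non-singular (`B″ = B` minus column `j`), then for some `η > 0` the corner graft `det (G_η + X^D·E_{inr j})` has at
least `2N` distinct positive roots — while BOTH its digits have none (`card_posRoots_det_skewBlock_pencil_eq_zero`,
`card_posRoots_det_skewBlock_minor_eq_zero`). [this work] -/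
theorem skewBlock_crossings {p q K : ℕ} (d : Fin K → ℕ) (l₀ : Fin K) (D : ℕ) (B : Fin K → Matrix (Fin p) (Fin (q + 1)) ℝ)
    (j : Fin (q + 1)) (N : ℕ) (τ ρ : ℕ → ℝ) (hτρ : ∀ i, τ i < ρ i) (hρτ : ∀ i, ρ i < τ (i + 1)) (hτpos : ∀ i, 0 < τ i)
    (hτB : ∀ i, i ≤ N → ((∑ l, τ i ^ d l • B l)ᵀ * (∑ l, τ i ^ d l • B l)).det ≠ 0)
    (hρB : ∀ i, i < N → ((∑ l, ρ i ^ d l • B l)ᵀ * (∑ l, ρ i ^ d l • B l)).det = 0)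
    (hρB'' : ∀ i, i < N → (((∑ l, ρ i ^ d l • B l).submatrix id j.succAbove)ᵀ *
      ((∑ l, ρ i ^ d l • B l).submatrix id j.succAbove)).det ≠ 0) :
    ∃ η : ℝ, 0 < η ∧ 2 * N ≤
      ((((∑ l, (X : ℝ[X]) ^ d l • (Matrix.fromBlocks (if l = l₀ then η • (1 : Matrix (Fin p) (Fin p) ℝ) else 0) (B l) (B l)ᵀ
          (if l = l₀ then -(η • (1 : Matrix (Fin (q + 1)) (Fin (q + 1)) ℝ)) else 0)).map C) +
        (X : ℝ[X]) ^ D • Matrix.single (Sum.inr j : Fin p ⊕ Fin (q + 1)) (Sum.inr j) (1 : ℝ[X])).det).roots.toFinset.filter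
        (fun t => 0 < t)).card := by
  classical
  -- the real `B`-pencil and its column-deleted version
  set Bt : ℝ → Matrix (Fin p) (Fin (q + 1)) ℝ := fun t => ∑ l, t ^ d l • B l with hBt
  -- the crossing polynomial in `η` at a fixed point `t`
  set Φ : ℝ → ℝ[X] := fun t =>
    X * C (t ^ d l₀ * t ^ D) * ((C ((t ^ d l₀) ^ 2) * X ^ 2) • (1 : Matrix (Fin q) (Fin q) ℝ[X]) +
        (((Bt t).submatrix id j.succAbove)ᵀ * (Bt t).submatrix id j.succAbove).map C).det -
      ((C ((t ^ d l₀) ^ 2) * X ^ 2) • (1 : Matrix (Fin (q + 1)) (Fin (q + 1)) ℝ[X]) + ((Bt t)ᵀ * Bt t).map C).det with hΦ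
  have hΦ0 : ∀ t, (Φ t).coeff 0 = -((Bt t)ᵀ * Bt t).det := fun t => by
    simp only [hΦ, coeff_sub, mul_assoc, coeff_X_mul_zero, coeff_zero_det_sq_smul_one_add, zero_sub]
  have hΦ1 : ∀ t, (Φ t).coeff 1 = t ^ d l₀ * t ^ D * (((Bt t).submatrix id j.succAbove)ᵀ * (Bt t).submatrix id j.succAbove).det :=
    fun t => by
    simp only [hΦ, coeff_sub, mul_assoc, coeff_X_mul, coeff_C_mul, coeff_zero_det_sq_smul_one_add,
      coeff_one_det_sq_smul_one_add, sub_zero]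
  -- the graft at `(η, t)` is a fixed-sign multiple of `(Φ t).eval η`
  have hgraft : ∀ η t : ℝ, 0 < η → 0 < t →
      (((∑ l, (X : ℝ[X]) ^ d l • (Matrix.fromBlocks (if l = l₀ then η • (1 : Matrix (Fin p) (Fin p) ℝ) else 0) (B l) (B l)ᵀ
          (if l = l₀ then -(η • (1 : Matrix (Fin (q + 1)) (Fin (q + 1)) ℝ)) else 0)).map C) +
        (X : ℝ[X]) ^ D • Matrix.single (Sum.inr j : Fin p ⊕ Fin (q + 1)) (Sum.inr j) (1 : ℝ[X])).det).eval t =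
      ((η * t ^ d l₀) ^ p * (-(η * t ^ d l₀)⁻¹) ^ q * (η * t ^ d l₀)⁻¹) * (Φ t).eval η := by
    intro η t hη ht
    have hc : η * t ^ d l₀ ≠ 0 := mul_ne_zero hη.ne' (pow_ne_zero _ ht.ne')
    rw [eval_det_pencil_add_corner, skewBlock_pencil_eval, det_skewBlock_add_corner _ hc]
    simp only [hΦ, eval_sub, eval_mul, eval_X, eval_C, eval_det_sq_smul_one_add]
    have e2 : (t ^ d l₀) ^ 2 * η ^ 2 = (η * t ^ d l₀) ^ 2 := by ring
    rw [e2]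
    field_simp
    ring
  -- thresholds at the `τ`'s (negative) and the `ρ`'s (positive)
  have Hτ : ∀ i, ∃ η₀ : ℝ, 0 < η₀ ∧ (i ≤ N → ∀ η, 0 < η → η < η₀ → (Φ (τ i)).eval η < 0) := by
    intro i
    by_cases hi : i ≤ N
    · have h0 : (Φ (τ i)).eval 0 < 0 := by
        rw [← coeff_zero_eq_eval_zero, hΦ0]
        have hpsd := (posSemidef_transpose_mul_self (Bt (τ i))).det_nonneg
        have hne := hτB i hi
        exact neg_neg_of_pos (lt_of_le_of_ne hpsd (Ne.symm hne))
      obtain ⟨η₀, h1, h2⟩ := exists_pos_forall_eval_neg _ h0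
      exact ⟨η₀, h1, fun _ => h2⟩
    · exact ⟨1, one_pos, fun h => absurd h hi⟩
  have Hρ : ∀ i, ∃ η₀ : ℝ, 0 < η₀ ∧ (i < N → ∀ η, 0 < η → η < η₀ → 0 < (Φ (ρ i)).eval η) := by
    intro i
    by_cases hi : i < N
    · have h0 : (Φ (ρ i)).coeff 0 = 0 := by rw [hΦ0, hρB i hi, neg_zero]
      have h1 : 0 < (Φ (ρ i)).coeff 1 := by
        rw [hΦ1]
        have hρpos : 0 < ρ i := (hτpos i).trans (hτρ i)
        have hpsd := (posSemidef_transpose_mul_self ((Bt (ρ i)).submatrix id j.succAbove)).det_nonneg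
        have hne := hρB'' i hi
        exact mul_pos (mul_pos (pow_pos hρpos _) (pow_pos hρpos _)) (lt_of_le_of_ne hpsd (Ne.symm hne))
      obtain ⟨η₀, h2, h3⟩ := exists_pos_forall_eval_pos_of_coeff _ h0 h1
      exact ⟨η₀, h2, fun _ => h3⟩
    · exact ⟨1, one_pos, fun h => absurd h hi⟩
  choose ητ hητ hτneg using Hτ
  choose ηρ hηρ hρpos' using Hρ
  -- one `η` below every threshold
  set Sη : Finset ℝ := (Finset.range (N + 1)).image ητ ∪ (Finset.range N).image ηρ with hSη
  have hSne : Sη.Nonempty := ⟨ητ 0, Finset.mem_union_left _ (Finset.mem_image.mpr ⟨0, Finset.mem_range.mpr (Nat.succ_pos N), rfl⟩)⟩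
  set η₁ := Sη.min' hSne with hη₁
  have hη₁pos : 0 < η₁ := by
    rw [hη₁, Finset.lt_min'_iff]
    intro y hy
    rcases Finset.mem_union.mp hy with hy | hy
    · obtain ⟨i, -, rfl⟩ := Finset.mem_image.mp hy; exact hητ i
    · obtain ⟨i, -, rfl⟩ := Finset.mem_image.mp hy; exact hηρ i
  have hη₁τ : ∀ i, i ≤ N → η₁ ≤ ητ i := fun i hi =>
    Finset.min'_le _ _ (Finset.mem_union_left _ (Finset.mem_image.mpr ⟨i, Finset.mem_range.mpr (Nat.lt_succ_of_le hi), rfl⟩))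
  have hη₁ρ : ∀ i, i < N → η₁ ≤ ηρ i := fun i hi =>
    Finset.min'_le _ _ (Finset.mem_union_right _ (Finset.mem_image.mpr ⟨i, Finset.mem_range.mpr hi, rfl⟩))
  set η := η₁ / 2 with hη
  have hηpos : 0 < η := by rw [hη]; positivity
  have hηlt : η < η₁ := by rw [hη]; linarith
  refine ⟨η, hηpos, ?_⟩
  -- signs of `Φ` at the certificate points
  have hnegτ : ∀ i, i ≤ N → (Φ (τ i)).eval η < 0 := fun i hi => hτneg i hi η hηpos (hηlt.trans_le (hη₁τ i hi))
  have hposρ : ∀ i, i < N → 0 < (Φ (ρ i)).eval η := fun i hi => hρpos' i hi η hηpos (hηlt.trans_le (hη₁ρ i hi))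
  -- the graft polynomial for this `η`
  set h : ℝ[X] := (((∑ l, (X : ℝ[X]) ^ d l • (Matrix.fromBlocks (if l = l₀ then η • (1 : Matrix (Fin p) (Fin p) ℝ) else 0) (B l) (B l)ᵀ
          (if l = l₀ then -(η • (1 : Matrix (Fin (q + 1)) (Fin (q + 1)) ℝ)) else 0)).map C) +
        (X : ℝ[X]) ^ D • Matrix.single (Sum.inr j : Fin p ⊕ Fin (q + 1)) (Sum.inr j) (1 : ℝ[X])).det) with hh
  have hprod : ∀ t₁ t₂ : ℝ, 0 < t₁ → 0 < t₂ → (Φ t₁).eval η * (Φ t₂).eval η < 0 → h.eval t₁ * h.eval t₂ < 0 := by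
    intro t₁ t₂ ht₁ ht₂ hlt
    rw [hh, hgraft η t₁ hηpos ht₁, hgraft η t₂ hηpos ht₂]
    have k1 := neg_one_pow_mul_skewFactor_pos (mul_pos hηpos (pow_pos ht₁ (d l₀))) p q
    have k2 := neg_one_pow_mul_skewFactor_pos (mul_pos hηpos (pow_pos ht₂ (d l₀))) p q
    have hsq : ((-1 : ℝ) ^ q) * ((-1 : ℝ) ^ q) = 1 := by rw [← mul_pow, neg_one_mul, neg_neg, one_pow]
    have key : ((η * t₁ ^ d l₀) ^ p * (-(η * t₁ ^ d l₀)⁻¹) ^ q * (η * t₁ ^ d l₀)⁻¹ * (Φ t₁).eval η) *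
        ((η * t₂ ^ d l₀) ^ p * (-(η * t₂ ^ d l₀)⁻¹) ^ q * (η * t₂ ^ d l₀)⁻¹ * (Φ t₂).eval η) =
        (((-1 : ℝ) ^ q * ((η * t₁ ^ d l₀) ^ p * (-(η * t₁ ^ d l₀)⁻¹) ^ q * (η * t₁ ^ d l₀)⁻¹)) *
          ((-1 : ℝ) ^ q * ((η * t₂ ^ d l₀) ^ p * (-(η * t₂ ^ d l₀)⁻¹) ^ q * (η * t₂ ^ d l₀)⁻¹))) *
          ((Φ t₁).eval η * (Φ t₂).eval η) := by
      have : ((-1 : ℝ) ^ q * ((η * t₁ ^ d l₀) ^ p * (-(η * t₁ ^ d l₀)⁻¹) ^ q * (η * t₁ ^ d l₀)⁻¹)) *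
          ((-1 : ℝ) ^ q * ((η * t₂ ^ d l₀) ^ p * (-(η * t₂ ^ d l₀)⁻¹) ^ q * (η * t₂ ^ d l₀)⁻¹)) =
          (((-1 : ℝ) ^ q) * ((-1 : ℝ) ^ q)) * (((η * t₁ ^ d l₀) ^ p * (-(η * t₁ ^ d l₀)⁻¹) ^ q * (η * t₁ ^ d l₀)⁻¹) *
            ((η * t₂ ^ d l₀) ^ p * (-(η * t₂ ^ d l₀)⁻¹) ^ q * (η * t₂ ^ d l₀)⁻¹)) := by ring
      rw [this, hsq, one_mul]; ring
    rw [key]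
    exact mul_neg_of_pos_of_neg (mul_pos k1 k2) hlt
  -- the interleaved certificate `τ 0 < ρ 0 < τ 1 < ⋯ < ρ (N-1) < τ N`
  set f : ℕ → ℝ := fun n => if n % 2 = 0 then τ (n / 2) else ρ (n / 2) with hf
  have hf_even : ∀ n : ℕ, n % 2 = 0 → f n = τ (n / 2) := fun n hn => by simp only [hf, if_pos hn]
  have hf_odd : ∀ n : ℕ, ¬ n % 2 = 0 → f n = ρ (n / 2) := fun n hn => by simp only [hf, if_neg hn]
  have hf_succ : ∀ n : ℕ, f n < f (n + 1) := by
    intro n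
    by_cases hn : n % 2 = 0
    · rw [hf_even n hn, hf_odd (n + 1) (by omega), show (n + 1) / 2 = n / 2 by omega]; exact hτρ _
    · rw [hf_odd n hn, hf_even (n + 1) (by omega), show (n + 1) / 2 = n / 2 + 1 by omega]; exact hρτ _
  have hf_mono : StrictMono f := strictMono_nat_of_lt_succ hf_succ
  have hf_pos : ∀ n, 0 < f n := by
    intro n
    by_cases hn : n % 2 = 0
    · rw [hf_even n hn]; exact hτpos _
    · rw [hf_odd n hn]; exact (hτpos _).trans (hτρ _)
  have hf_alt : ∀ n : ℕ, n + 1 ≤ 2 * N → h.eval (f n) * h.eval (f (n + 1)) < 0 := by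
    intro n hn
    refine hprod _ _ (hf_pos n) (hf_pos (n + 1)) ?_
    by_cases hpar : n % 2 = 0
    · rw [hf_even n hpar, hf_odd (n + 1) (by omega), show (n + 1) / 2 = n / 2 by omega]
      exact mul_neg_of_neg_of_pos (hnegτ _ (by omega)) (hposρ _ (by omega))
    · rw [hf_odd n hpar, hf_even (n + 1) (by omega), show (n + 1) / 2 = n / 2 + 1 by omega]
      exact mul_neg_of_pos_of_neg (hposρ _ (by omega)) (hnegτ _ (by omega))
  have hcnt := Summit.ValiantsHypothesis.ValiantsHypothesis.Theorems.SymmetroidDescartes.le_card_posRoots_of_alternating h (2 * N)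
    (fun i => f (i : ℕ)) (fun a b hab => hf_mono hab) (fun i => hf_pos i) (fun i => by
      have e1 : ((Fin.castSucc i : Fin (2 * N + 1)) : ℕ) = (i : ℕ) := rfl
      have e2 : ((Fin.succ i : Fin (2 * N + 1)) : ℕ) = (i : ℕ) + 1 := rfl
      simp only [e1, e2]
      exact hf_alt i (by omega))
  simpa [hh] using hcnt

/-- **THE SKEW-BLOCK PHANTOMS, PACKAGED**: one `η > 0` for which BOTH digits of the corner graft are rootless on `(0,∞)` and the graft has
at least `2N` distinct positive roots. [this work] -/
theorem skewBlock_phantoms {p q K : ℕ} (d : Fin K → ℕ) (l₀ : Fin K) (D : ℕ) (B : Fin K → Matrix (Fin p) (Fin (q + 1)) ℝ)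
    (j : Fin (q + 1)) (N : ℕ) (τ ρ : ℕ → ℝ) (hτρ : ∀ i, τ i < ρ i) (hρτ : ∀ i, ρ i < τ (i + 1)) (hτpos : ∀ i, 0 < τ i)
    (hτB : ∀ i, i ≤ N → ((∑ l, τ i ^ d l • B l)ᵀ * (∑ l, τ i ^ d l • B l)).det ≠ 0)
    (hρB : ∀ i, i < N → ((∑ l, ρ i ^ d l • B l)ᵀ * (∑ l, ρ i ^ d l • B l)).det = 0)
    (hρB'' : ∀ i, i < N → (((∑ l, ρ i ^ d l • B l).submatrix id j.succAbove)ᵀ *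
      ((∑ l, ρ i ^ d l • B l).submatrix id j.succAbove)).det ≠ 0) :
    ∃ η : ℝ, 0 < η ∧
      ((∑ l, (X : ℝ[X]) ^ d l • (Matrix.fromBlocks (if l = l₀ then η • (1 : Matrix (Fin p) (Fin p) ℝ) else 0) (B l) (B l)ᵀ
        (if l = l₀ then -(η • (1 : Matrix (Fin (q + 1)) (Fin (q + 1)) ℝ)) else 0)).map C).det.roots.toFinset.filter
        (fun t => 0 < t)).card = 0 ∧
      (((∑ l, (X : ℝ[X]) ^ d l • (Matrix.fromBlocks (if l = l₀ then η • (1 : Matrix (Fin p) (Fin p) ℝ) else 0) (B l) (B l)ᵀ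
        (if l = l₀ then -(η • (1 : Matrix (Fin (q + 1)) (Fin (q + 1)) ℝ)) else 0)).map C).submatrix
        (Sum.map id j.succAbove) (Sum.map id j.succAbove)).det.roots.toFinset.filter (fun t => 0 < t)).card = 0 ∧
      2 * N ≤
      ((((∑ l, (X : ℝ[X]) ^ d l • (Matrix.fromBlocks (if l = l₀ then η • (1 : Matrix (Fin p) (Fin p) ℝ) else 0) (B l) (B l)ᵀ
          (if l = l₀ then -(η • (1 : Matrix (Fin (q + 1)) (Fin (q + 1)) ℝ)) else 0)).map C) +
        (X : ℝ[X]) ^ D • Matrix.single (Sum.inr j : Fin p ⊕ Fin (q + 1)) (Sum.inr j) (1 : ℝ[X])).det).roots.toFinset.filter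
        (fun t => 0 < t)).card := by
  obtain ⟨η, hη, hN⟩ := skewBlock_crossings d l₀ D B j N τ ρ hτρ hρτ hτpos hτB hρB hρB''
  exact ⟨η, hη, card_posRoots_det_skewBlock_pencil_eq_zero d l₀ hη.ne' B,
    card_posRoots_det_skewBlock_minor_eq_zero d l₀ hη.ne' B j, hN⟩

/-- for SQUARE `B` (`p = q + 1`), `det(BᵀB) = (det B)²`: the singularity hypotheses of `skewBlock_crossings` read off `det B`. [folklore] -/
theorem det_transpose_mul_self_eq_sq {k : ℕ} (B : Matrix (Fin k) (Fin k) ℝ) : (Bᵀ * B).det = B.det ^ 2 := by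
  rw [Matrix.det_mul, Matrix.det_transpose, sq]

/-- **square form**: `det B(τᵢ) ≠ 0`, `det B(ρᵢ) = 0` and `B″(ρᵢ)` of full column rank give `2N` phantoms with rootless digits. [this work] -/
theorem skewBlock_phantoms_square {q K : ℕ} (d : Fin K → ℕ) (l₀ : Fin K) (D : ℕ) (B : Fin K → Matrix (Fin (q + 1)) (Fin (q + 1)) ℝ)
    (j : Fin (q + 1)) (N : ℕ) (τ ρ : ℕ → ℝ) (hτρ : ∀ i, τ i < ρ i) (hρτ : ∀ i, ρ i < τ (i + 1)) (hτpos : ∀ i, 0 < τ i)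
    (hτB : ∀ i, i ≤ N → (∑ l, τ i ^ d l • B l).det ≠ 0)
    (hρB : ∀ i, i < N → (∑ l, ρ i ^ d l • B l).det = 0)
    (hρB'' : ∀ i, i < N → (((∑ l, ρ i ^ d l • B l).submatrix id j.succAbove)ᵀ *
      ((∑ l, ρ i ^ d l • B l).submatrix id j.succAbove)).det ≠ 0) :
    ∃ η : ℝ, 0 < η ∧
      ((∑ l, (X : ℝ[X]) ^ d l • (Matrix.fromBlocks (if l = l₀ then η • (1 : Matrix (Fin (q + 1)) (Fin (q + 1)) ℝ) else 0) (B l)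
        (B l)ᵀ (if l = l₀ then -(η • (1 : Matrix (Fin (q + 1)) (Fin (q + 1)) ℝ)) else 0)).map C).det.roots.toFinset.filter
        (fun t => 0 < t)).card = 0 ∧
      (((∑ l, (X : ℝ[X]) ^ d l • (Matrix.fromBlocks (if l = l₀ then η • (1 : Matrix (Fin (q + 1)) (Fin (q + 1)) ℝ) else 0) (B l)
        (B l)ᵀ (if l = l₀ then -(η • (1 : Matrix (Fin (q + 1)) (Fin (q + 1)) ℝ)) else 0)).map C).submatrix
        (Sum.map id j.succAbove) (Sum.map id j.succAbove)).det.roots.toFinset.filter (fun t => 0 < t)).card = 0 ∧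
      2 * N ≤
      ((((∑ l, (X : ℝ[X]) ^ d l • (Matrix.fromBlocks (if l = l₀ then η • (1 : Matrix (Fin (q + 1)) (Fin (q + 1)) ℝ) else 0) (B l)
          (B l)ᵀ (if l = l₀ then -(η • (1 : Matrix (Fin (q + 1)) (Fin (q + 1)) ℝ)) else 0)).map C) +
        (X : ℝ[X]) ^ D • Matrix.single (Sum.inr j : Fin (q + 1) ⊕ Fin (q + 1)) (Sum.inr j) (1 : ℝ[X])).det).roots.toFinset.filter
        (fun t => 0 < t)).card :=
  skewBlock_phantoms d l₀ D B j N τ ρ hτρ hρτ hτpos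
    (fun i hi => by rw [det_transpose_mul_self_eq_sq]; exact pow_ne_zero 2 (hτB i hi))
    (fun i hi => by rw [det_transpose_mul_self_eq_sq, hρB i hi]; ring)
    hρB''

end Crossings

end Summit.ValiantsHypothesis.ValiantsHypothesis.Theorems.KPlusLogSqLaw.TowerGraft
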